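import Literature.RepresentationTheory.HeisenbergGroup.WeylLatticePairTensorIrreducible
import Literature.RepresentationTheory.HeisenbergGroup.HeisenbergPairUniqueness
import HarnessLib

/-!
# `(real Heisenberg representation on L²(μ)) ⊗ (lattice-pair Heisenberg representation on L²(ν))` is IRREDUCIBLE on
# `L²(μ ⊗ ν)` — the shape `H(W_∞) · H(W_fin)` of the adelic Heisenberg group, with no Weyl system in the statement

Topic `RepresentationTheory/HeisenbergGroup`; namespace `Literature.RepresentationTheory.HeisenbergGroup`.  KERNEL ONLY:
theorems; no definition, no named fact, no record, no `sorry`.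

`WeylLatticePairTensorIrreducible.lean` proves: an IRREDUCIBLE Weyl system `W₁` on `L²(μ)` and an IRREDUCIBLE
lattice-pair `ψ`-representation `τ₂` of `Heisenberg (polar β)` on `L²(ν)` amplify to a jointly irreducible pair
`(W₁ ⊗ 1, 1 ⊗ τ₂)` on `L²(μ ⊗ ν)` ([vonNeumann1931, §5]; the shape of [GelbartRogawski1991, §3.1 p. 454 L19–21]'s
`ρ_ψ = ρ_∞ ⊗ ρ_fin`).  As `HeisenbergPairUniqueness.lean` did for UNIQUENESS, this file removes the Weyl system from the
statement of IRREDUCIBILITY: the archimedean datum is a representation `π₁` of `Heisenberg B`, `B : X →ₗ[R] X →ₗ[R] R`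
over a commutative `ℝ`-algebra `R` on a finite-dimensional real normed space `X` (the shape of `H(W_∞)` over
`F ⊗ ℝ = ∏_{v∣∞} F_v`), on `L²(μ)` by linear isometries with continuous orbit maps and central character `𝐞 ∘ ℓ`
(`ℓ : R → ℝ` onto, real commutator form `ℓ(B(y, y') − B(y', y))` non-degenerate: "`ψ` non-trivial" at every
archimedean place).

* §1 `centralChar_of_tensor_left`, `continuous_of_tensor_left` — the amplification `π = π₁ ⊗ 1` (given by its
  values on the tensors `f ⊗ g`, [ReedSimonI1980, §II.4, §VIII.10]) inherits the central character and the strong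
  continuity of `π₁`;
* §2 **`irreducible_tensor_of_irreducible_heisenberg_pair`** — `π₁` irreducible on `L²(μ) ≠ 0`, `τ₂` irreducible on
  `L²(ν) ≠ 0` (isometric, continuous orbit maps, central character `ψ`, dual lattice pair `(B₁, B₂)` for `ψ(β x y)` with
  shrinking unit scalings), `π = π₁ ⊗ 1`, `τ = 1 ⊗ τ₂` isometric representations on `L²(μ ⊗ ν)` with the tensor
  formulas.  Then a closed subspace of `L²(μ ⊗ ν)` invariant under all `π(h)`, `τ(h')` is `⊥` or `⊤`.
  Proof: in symplectic coordinates of `ℓ ∘ B` (`SegalBargmann.exists_symplecticCoords`) `π₁` and `π` give Weyl systems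
  `W₁`, `W` (`exists_isWeylSystem_of_centralChar`) whose operators are unit multiples of `π₁(y, 0)`, `π(y, 0)`; so
  `W = W₁ ⊗ 1` on tensors, `W₁` is irreducible, the subspace is `W`-invariant, and
  `IsWeylSystem.irreducible_tensor_of_irreducible` applies.

With `HeisenbergPairUniqueness.jointly_irreducible_of_generated` this is the irreducibility of ONE representation of a
group generated by two commuting images `ι₁(H(W_∞)) · ι₂(H(W_fin))` acting on `L²(μ ⊗ ν)` through such a pair — the
`L²` model of the adelic `ρ_ψ`.  Nothing of the cited sources is asserted; everything is proved from Mathlib and the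
tree.

## References
* [vonNeumann1931] J. von Neumann, *Die Eindeutigkeit der Schrödingerschen Operatoren*, Math. Ann. 104 (1931)
  570–578, §5.
* [Folland1989] G. B. Folland, *Harmonic Analysis in Phase Space*, Princeton UP (1989), §1.5 Theorem (1.50).
* [ReedSimonI1980] M. Reed, B. Simon, *Methods of Modern Mathematical Physics I* (1980), §II.4 Thm II.10, §VIII.10.
* [Weil1964] A. Weil, Acta Math. 111 (1964), Chap. I n° 11, Chap. III n° 37–39.
* [GelbartRogawski1991] S. Gelbart, J. Rogawski, Invent. Math. 105 (1991), §3.1 p. 454 L17–21.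
-/

set_option autoImplicit false

noncomputable section

open MeasureTheory Complex Filter Set
open scoped InnerProductSpace Topology FourierTransform Pointwise
open Literature.MeasureTheory.Integral Literature.Analysis.SegalBargmann

namespace Literature.RepresentationTheory.HeisenbergGroup

variable {Ω₁ Ω₂ : Type*} [MeasurableSpace Ω₁] [MeasurableSpace Ω₂] (μ : Measure Ω₁) (ν : Measure Ω₂)
  [SigmaFinite μ] [SigmaFinite ν]

/-! ## §1 The amplification `π₁ ⊗ 1` of a representation with central character `𝐞 ∘ ℓ` -/

section Amplification

variable {R : Type*} [CommRing R]

/-- **a scalar on `L²(μ)` amplifies to the same scalar on `L²(μ ⊗ ν)`**: if `π₁(z) = c • 1` then `(π₁ ⊗ 1)(z) = c • 1`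
(both bounded operators agree on the total family of tensors). [cite: ReedSimonI1980, §VIII.10] -/
theorem apply_eq_smul_of_tensor_left {G : Type*} [Group G] {π₁ : Representation ℂ G (Lp ℂ 2 μ)}
    (π : Representation ℂ G (Lp ℂ 2 (μ.prod ν)))
    (hπt : ∀ (g : G) (f : Lp ℂ 2 μ) (h : Lp ℂ 2 ν),
      π g ((memLp_tensor_Lp μ ν f h).toLp _) = (memLp_tensor_Lp μ ν (π₁ g f) h).toLp _)
    (hπu : ∀ (g : G) (F : Lp ℂ 2 (μ.prod ν)), ‖π g F‖ = ‖F‖)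
    (z : G) (c : ℂ) (hz : ∀ f : Lp ℂ 2 μ, π₁ z f = c • f) (F : Lp ℂ 2 (μ.prod ν)) : π z F = c • F := by
  set P : Lp ℂ 2 (μ.prod ν) →L[ℂ] Lp ℂ 2 (μ.prod ν) :=
    ⟨π z, (AddMonoidHomClass.isometry_of_norm (π z) (hπu z)).continuous⟩ with hP
  have key : P = c • ContinuousLinearMap.id ℂ (Lp ℂ 2 (μ.prod ν)) := by
    refine clm_eq_of_forall_tensor μ ν _ _ fun f g => ?_
    change π z ((memLp_tensor_Lp μ ν f g).toLp _) = c • (memLp_tensor_Lp μ ν f g).toLp _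
    rw [hπt, hz, toLp_tensor_smul_left]
  have e := DFunLike.congr_fun key F
  change π z F = c • F at e
  exact e

/-- **the central character passes to the amplification**: if the centre of `Heisenberg B` acts on `L²(μ)` by `𝐞 ∘ ℓ`
through `π₁`, it acts by `𝐞 ∘ ℓ` on `L²(μ ⊗ ν)` through `π₁ ⊗ 1`. [cite: ReedSimonI1980, §VIII.10] -/
theorem centralChar_of_tensor_left [Algebra ℝ R] {X : Type*} [AddCommGroup X] [Module R X]
    (B : X →ₗ[R] X →ₗ[R] R) (ℓ : R →ₗ[ℝ] ℝ) {π₁ : Representation ℂ (Heisenberg B) (Lp ℂ 2 μ)}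
    (π : Representation ℂ (Heisenberg B) (Lp ℂ 2 (μ.prod ν)))
    (hπt : ∀ (g : Heisenberg B) (f : Lp ℂ 2 μ) (h : Lp ℂ 2 ν),
      π g ((memLp_tensor_Lp μ ν f h).toLp _) = (memLp_tensor_Lp μ ν (π₁ g f) h).toLp _)
    (hπu : ∀ (g : Heisenberg B) (F : Lp ℂ 2 (μ.prod ν)), ‖π g F‖ = ‖F‖)
    (h₁z : ∀ (t : R) (f : Lp ℂ 2 μ),
      π₁ (Heisenberg.ofCenter B (Multiplicative.ofAdd t)) f = ((𝐞 (ℓ t) : Circle) : ℂ) • f)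
    (t : R) (F : Lp ℂ 2 (μ.prod ν)) :
    π (Heisenberg.ofCenter B (Multiplicative.ofAdd t)) F = ((𝐞 (ℓ t) : Circle) : ℂ) • F :=
  apply_eq_smul_of_tensor_left μ ν π hπt hπu _ _ (h₁z t) F

/-- **strong continuity passes to the amplification**: continuous orbit maps `y ↦ π₁(y, 0) f` give continuous orbit
maps `y ↦ (π₁ ⊗ 1)(y, 0) F`. [cite: ReedSimonI1980, §VIII.10] -/
theorem continuous_of_tensor_left {V : Type*} [AddCommGroup V] [Module R V] [TopologicalSpace V]
    {C : V →ₗ[R] V →ₗ[R] R}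
    {π₁ : Representation ℂ (Heisenberg C) (Lp ℂ 2 μ)} (π : Representation ℂ (Heisenberg C) (Lp ℂ 2 (μ.prod ν)))
    (hπt : ∀ (g : Heisenberg C) (f : Lp ℂ 2 μ) (h : Lp ℂ 2 ν),
      π g ((memLp_tensor_Lp μ ν f h).toLp _) = (memLp_tensor_Lp μ ν (π₁ g f) h).toLp _)
    (hπu : ∀ (g : Heisenberg C) (F : Lp ℂ 2 (μ.prod ν)), ‖π g F‖ = ‖F‖)
    (h₁c : ∀ f : Lp ℂ 2 μ, Continuous fun y : V => π₁ ⟨y, 0⟩ f) (F : Lp ℂ 2 (μ.prod ν)) :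
    Continuous fun y : V => π ⟨y, 0⟩ F :=
  continuous_rep_tensor_left_apply μ ν π hπt hπu (fun y : V => (⟨y, 0⟩ : Heisenberg C)) h₁c F

end Amplification

/-! ## §2 The irreducibility theorem for the pair `(π₁ ⊗ 1, 1 ⊗ τ₂)` -/

section Pair

variable {R : Type*} [CommRing R] [Algebra ℝ R]
  {X : Type*} [NormedAddCommGroup X] [NormedSpace ℝ X] [FiniteDimensional ℝ X] [Module R X] [IsScalarTower ℝ R X]
  (B : X →ₗ[R] X →ₗ[R] R) (ℓ : R →ₗ[ℝ] ℝ)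
  {Rf : Type*} [CommRing Rf] {Xf Yf : Type*} [AddCommGroup Xf] [Module Rf Xf] [AddCommGroup Yf] [Module Rf Yf]
  [TopologicalSpace Xf] [IsTopologicalAddGroup Xf] [ContinuousConstSMul Rf Xf]
  [TopologicalSpace Yf] [IsTopologicalAddGroup Yf] [ContinuousConstSMul Rf Yf]
  (β : Xf →ₗ[Rf] Yf →ₗ[Rf] Rf) (ψ : AddChar Rf Circle) {B₁ : AddSubgroup Xf} {B₂ : AddSubgroup Yf}

/-- **irreducible ⊗ irreducible is irreducible, for a real Heisenberg group times a lattice-pair Heisenberg group on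
`L²(μ ⊗ ν)`.**  Data: `π₁` an IRREDUCIBLE representation of `Heisenberg B` (`B` over a commutative `ℝ`-algebra `R`, on
a finite-dimensional real normed space `X`) on `L²(μ) ≠ 0` by linear isometries, with continuous orbit maps
`y ↦ π₁(y, 0) f` and central character `𝐞 ∘ ℓ`, `ℓ : R → ℝ` onto, `ℓ(B(y, y') − B(y', y))` non-degenerate; `τ₂` an
IRREDUCIBLE representation of `Heisenberg (polar β)` on `L²(ν) ≠ 0` by linear isometries with continuous orbit maps
`w ↦ τ₂(w, 0) g` and central character `ψ`, `(B₁, B₂)` a dual lattice pair for `ψ(β x y)` whose unit scalings shrink to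
`0`; `π`, `τ` isometric representations on `L²(μ ⊗ ν)` with `π(h)(f ⊗ g) = π₁(h) f ⊗ g` and
`τ(h')(f ⊗ g) = f ⊗ τ₂(h') g`.  Then a closed subspace of `L²(μ ⊗ ν)` invariant under all `π(h)` and all `τ(h')` is
`⊥` or `⊤` — the irreducibility of the `L²` model `ρ_∞ ⊗ ρ_fin` of the adelic `ρ_ψ`.
[cite: vonNeumann1931, §5] [cite: GelbartRogawski1991, §3.1 p. 454 L19–21] -/
theorem irreducible_tensor_of_irreducible_heisenberg_pair [Nontrivial (Lp ℂ 2 μ)] [Nontrivial (Lp ℂ 2 ν)]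
    (hℓ : Function.Surjective ℓ) (hs : (realForm B ℓ - (realForm B ℓ).flip).Nondegenerate)
    (hB : IsDualLatticePair β ψ B₁ B₂)
    (hX : ∀ N ∈ 𝓝 (0 : Xf), ∃ a : Rfˣ, (((a : Rf) • B₁ : AddSubgroup Xf) : Set Xf) ⊆ N)
    (hY : ∀ N ∈ 𝓝 (0 : Yf), ∃ a : Rfˣ, (((a : Rf) • B₂ : AddSubgroup Yf) : Set Yf) ⊆ N)
    (π₁ : Representation ℂ (Heisenberg B) (Lp ℂ 2 μ))
    (h₁u : ∀ (h : Heisenberg B) (f : Lp ℂ 2 μ), ‖π₁ h f‖ = ‖f‖)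
    (h₁c : ∀ f : Lp ℂ 2 μ, Continuous fun y : X => π₁ ⟨y, 0⟩ f)
    (h₁z : ∀ (t : R) (f : Lp ℂ 2 μ),
      π₁ (Heisenberg.ofCenter B (Multiplicative.ofAdd t)) f = ((𝐞 (ℓ t) : Circle) : ℂ) • f)
    (h₁i : ∀ K : Submodule ℂ (Lp ℂ 2 μ), IsClosed (K : Set (Lp ℂ 2 μ)) →
      (∀ (h : Heisenberg B), ∀ f ∈ K, π₁ h f ∈ K) → K = ⊥ ∨ K = ⊤)
    (τ₂ : Representation ℂ (Heisenberg (polar β)) (Lp ℂ 2 ν))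
    (h₂u : ∀ (h : Heisenberg (polar β)) (g : Lp ℂ 2 ν), ‖τ₂ h g‖ = ‖g‖)
    (h₂c : ∀ g : Lp ℂ 2 ν, Continuous fun w : Xf × Yf => τ₂ ⟨w, 0⟩ g)
    (h₂z : ∀ (t : Rf) (g : Lp ℂ 2 ν),
      τ₂ (Heisenberg.ofCenter (polar β) (Multiplicative.ofAdd t)) g = ((ψ t : Circle) : ℂ) • g)
    (h₂i : ∀ K : Submodule ℂ (Lp ℂ 2 ν), IsClosed (K : Set (Lp ℂ 2 ν)) →
      (∀ (h : Heisenberg (polar β)), ∀ g ∈ K, τ₂ h g ∈ K) → K = ⊥ ∨ K = ⊤)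
    (π : Representation ℂ (Heisenberg B) (Lp ℂ 2 (μ.prod ν)))
    (hπt : ∀ (h : Heisenberg B) (f : Lp ℂ 2 μ) (g : Lp ℂ 2 ν),
      π h ((memLp_tensor_Lp μ ν f g).toLp _) = (memLp_tensor_Lp μ ν (π₁ h f) g).toLp _)
    (hπu : ∀ (h : Heisenberg B) (F : Lp ℂ 2 (μ.prod ν)), ‖π h F‖ = ‖F‖)
    (τ : Representation ℂ (Heisenberg (polar β)) (Lp ℂ 2 (μ.prod ν)))
    (hτt : ∀ (h : Heisenberg (polar β)) (f : Lp ℂ 2 μ) (g : Lp ℂ 2 ν),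
      τ h ((memLp_tensor_Lp μ ν f g).toLp _) = (memLp_tensor_Lp μ ν f (τ₂ h g)).toLp _)
    (hτu : ∀ (h : Heisenberg (polar β)) (F : Lp ℂ 2 (μ.prod ν)), ‖τ h F‖ = ‖F‖)
    (K : Submodule ℂ (Lp ℂ 2 (μ.prod ν))) (hKc : IsClosed (K : Set (Lp ℂ 2 (μ.prod ν))))
    (hKπ : ∀ (h : Heisenberg B), ∀ F ∈ K, π h F ∈ K)
    (hKτ : ∀ (h : Heisenberg (polar β)), ∀ F ∈ K, τ h F ∈ K) : K = ⊥ ∨ K = ⊤ := by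
  -- continuity and central character of the amplification `π = π₁ ⊗ 1`
  have hπc : ∀ F : Lp ℂ 2 (μ.prod ν), Continuous fun y : X => π ⟨y, 0⟩ F :=
    continuous_of_tensor_left μ ν π hπt hπu h₁c
  have hπz : ∀ (t : R) (F : Lp ℂ 2 (μ.prod ν)),
      π (Heisenberg.ofCenter B (Multiplicative.ofAdd t)) F = ((𝐞 (ℓ t) : Circle) : ℂ) • F :=
    centralChar_of_tensor_left μ ν B ℓ π hπt hπu h₁z
  -- symplectic coordinates of the real form, and the Weyl systems of `π₁` and `π`
  obtain ⟨n, e, he⟩ := exists_symplecticCoords (realForm B ℓ) hs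
  obtain ⟨W₁, hW₁, hW₁π⟩ := exists_isWeylSystem_of_centralChar B ℓ e he hℓ π₁ h₁u h₁c h₁z
  obtain ⟨W, hW, hWπ⟩ := exists_isWeylSystem_of_centralChar B ℓ e he hℓ π hπu hπc hπz
  -- `W = W₁ ⊗ 1` on tensors
  have hWt : ∀ (x : PhaseSpace (Fin n)) (f : Lp ℂ 2 μ) (g : Lp ℂ 2 ν),
      W x ((memLp_tensor_Lp μ ν f g).toLp _) = (memLp_tensor_Lp μ ν (W₁ x f) g).toLp _ := by
    intro x f g
    rw [hWπ, hπt, hW₁π, toLp_tensor_smul_left]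
  -- `π₁(y, 0)` is a unit multiple of `W₁(x_y)`, so `W₁` is irreducible
  have hxy : ∀ y : X, e.symm (phaseEquiv (Fin n) ((phaseEquiv (Fin n)).symm (e y))) = y := fun y => by
    rw [LinearEquiv.apply_symm_apply, LinearEquiv.symm_apply_apply]
  have hπ₁W : ∀ (y : X) (f : Lp ℂ 2 μ), π₁ ⟨y, 0⟩ f = (((𝐞 (realForm B ℓ y y / 2) : Circle) : ℂ))⁻¹ •
      W₁ ((phaseEquiv (Fin n)).symm (e y)) f := fun y f => by
    rw [hW₁π, hxy, smul_smul, inv_mul_cancel₀ (Circle.coe_ne_zero _), one_smul]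
  have h₁i' : ∀ K₁ : Submodule ℂ (Lp ℂ 2 μ), IsClosed (K₁ : Set (Lp ℂ 2 μ)) →
      (∀ (x : PhaseSpace (Fin n)), ∀ f ∈ K₁, W₁ x f ∈ K₁) → K₁ = ⊥ ∨ K₁ = ⊤ := by
    intro K₁ hK₁c hK₁W
    refine h₁i K₁ hK₁c fun h f hf => apply_mem_of_forall_mk_zero_mem B ℓ π₁ h₁z K₁ (fun y w hw => ?_) h hf
    rw [hπ₁W]
    exact K₁.smul_mem _ (hK₁W _ w hw)
  -- the subspace is `W`-invariant
  have hKW : ∀ (x : PhaseSpace (Fin n)), ∀ F ∈ K, W x F ∈ K := fun x F hF => by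
    rw [hWπ]
    exact K.smul_mem _ (hKπ _ F hF)
  exact hW₁.irreducible_tensor_of_irreducible μ ν β ψ h₁i' hW hWt τ₂ h₂u h₂c h₂z h₂i hB hX hY τ hτt hτu K hKc hKW hKτ

end Pair

end Literature.RepresentationTheory.HeisenbergGroup

end
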